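import Summits.QuantumFields.YangMills.Theorems.LuscherReductionTwistedTraceScalingBOStiffCoreCoeff
import Summits.QuantumFields.YangMills.Theorems.FlatTubeReductionStiffKDefs
import HarnessLib


/-!
# (B-ST) K-port, part 2: the ν-TAIL OF THE RECORD PROFILE off the core and the fibre mass from above, at a GENERAL CAP CONSTANT `K ≥ 1`
# (route `FlatTubeReduction`, crux K1 `NearFlatRatioLaw` stmt-QuantumFields-24720, line `ratepack_v2`, stub `stub_hST_A`; seat `ym-line-ftr-p1` g20; R2b1 RECORD rung — no summit statement is proved here)

Lane A's ✓`…BOStiffFibreTail.eventually_fibre_tail_le(_mul_recordGamma)` and ✓`…BOStiffCoreCoeff.fibre_sq_mass_le` VERBATIM with the cap constant `43` of `recordChi L s 43 M β`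
replaced by a parameter `K ≥ 1` (the rate twin's stub `stub_hST_A` needs `K = 42·max 1 (|Site 3 L|/7) + 1` at `s = 1/6`):
* ★ `fibre_sq_mass_le_K` — `∫ Ω_c(x̂)²·softWeight χ_K (orthoTube u x) dπ ≤ (1+κ)·γ(β)` for EVERY `u`;
* ★★ `eventually_fibre_tail_le_K`, ★★★ `eventually_fibre_tail_le_mul_recordGamma_K` — the profile mass off the core is `≤ a·γ(β)` for every `a > 0`, eventually.
HONEST FRAMING: text port (slot substitution `43 ↦ K`) of lane A's bookkeeping for a stub of the crux K1 of the CONDITIONAL route R2b1 (RECORD rung); no new mathematics; not infinite volume,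
not a gap, not Clay.
-/

set_option autoImplicit false

noncomputable section

open MeasureTheory Filter Topology Real
open scoped BigOperators
open Literature.MathematicalPhysics.QuantumFieldTheory
open Literature.MathematicalPhysics.QuantumLattice

namespace Summit.QuantumFields.YangMills.Theorems.FemtoTransferGap.TwoLattice.ConstTube

open Summit.QuantumFields.YangMills.Theorems.FemtoTransferGap
open Summit.QuantumFields.YangMills.Theorems.FemtoTransferGap.TwoLattice
open Summit.QuantumFields.YangMills.Theorems.FemtoTransferGap.TwoLattice.Avg
open Summit.QuantumFields.YangMills.Theorems.FemtoTransferGap.TwoLattice.Stiff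
open Summit.QuantumFields.YangMills.Theorems.FemtoTransferGap.TwoLattice.GnChart
open Summit.QuantumFields.YangMills.Theorems.FemtoTransferGap.TwoLattice.Cov
open Summit.QuantumFields.YangMills.Theorems.FemtoTransferGap.TwoLattice.Toron

variable {L : ℕ} [NeZero L]

/-! ## §1 The fibre mass from above, every slow `u` -/

/-- ★ **THE FIBRE MASS FROM ABOVE, FOR EVERY slow `u`**: with (P)'s upper bound `gaugeAvg χ ≤ N̄(β^{-1})(1+κ)` on the fat tube,
`∫ Ω_c(x̂)²·softWeight χ (orthoTube u x) dπ ≤ (1+κ)·γ(β)` (`γ = N̄·M₂`, `recordGamma_eq`). [cite: Luscher1983, §3] -/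
theorem fibre_sq_mass_le_K (s K M β : ℝ) {κ : ℝ} (hκ : 0 ≤ κ)
    (hP : ∀ U ∈ fatTubeRho L (fun β => K * powScale s β) (fun b => M * (K * powScale s b)) β,
      gaugeAvg (recordChi L s K M β) U ≤ fpWeightBar L (powScale 1 β) * (1 + κ)) (u : GaugeConfig 3 1 SU2) :
    ∫ x, ({x : LinkSpace L | linkCurry x ∈ capBalancedSet L}.indicator (fun _ => (1 : ℝ)) (linkEmbed L x) *
          frozenProfile L (fun β' => stiffGaussExp L (β' / 2) β') (fun β' => min (1 / 40) (powScale (1 / 2) β' * btLog β')) β (linkEmbed L x)) ^ 2 *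
        softWeight (recordChi L s K M β) (orthoTube L u x) ∂orthoTransverse L ≤
      (1 + κ) * recordGamma L (fun β' => fun x : LinkSpace L => {x : LinkSpace L | linkCurry x ∈ capBalancedSet L}.indicator (fun _ => (1 : ℝ)) x *
        frozenProfile L (fun β'' => stiffGaussExp L (β'' / 2) β'') (fun β'' => min (1 / 40) (powScale (1 / 2) β'' * btLog β'')) β' x) β := by
  haveI := isFiniteMeasure_orthoTransverse L
  set Nbar := fpWeightBar L (powScale 1 β) with hNbar
  have hNbar0 : 0 < Nbar := fpWeightBar_pos L (powScale_pos 1 β)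
  set F := fatTubeRho L (fun β => K * powScale s β) (fun b => M * (K * powScale s b)) β with hFdef
  set I : (Edge 3 L → Fin 3 → ℝ) → ℝ := fun v =>
    Real.exp (-(stiffGaussExp L (β / 2) β (linkEmbed L v))) ^ 2 * Real.exp (-(‖(gaugeModes L).starProjection (linkEmbed L v)‖ ^ 2 / powScale 1 β ^ 2)) with hIdef
  have hIm : Measurable I := measurable_record_integrand (L := L) β
  have hI01 : ∀ v, 0 ≤ I v ∧ I v ≤ 1 := fun v => by
    refine ⟨by rw [hIdef]; positivity, ?_⟩
    have h1 : Real.exp (-(stiffGaussExp L (β / 2) β (linkEmbed L v))) ^ 2 ≤ 1 :=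
      pow_le_one₀ (Real.exp_pos _).le (Real.exp_le_one_iff.mpr (neg_nonpos.mpr (stiffGaussExp_nonneg _ _ _)))
    have h2 : Real.exp (-(‖(gaugeModes L).starProjection (linkEmbed L v)‖ ^ 2 / powScale 1 β ^ 2)) ≤ 1 :=
      Real.exp_le_one_iff.mpr (neg_nonpos.mpr (by positivity))
    calc I v ≤ 1 * 1 := mul_le_mul h1 h2 (Real.exp_pos _).le zero_le_one
      _ = 1 := one_mul _
  set B : Set (Edge 3 L → Fin 3 → ℝ) := {v | ‖linkEmbed L v‖ ≤ min (1 / 40) (powScale (1 / 2) β * btLog β)} with hBdef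
  have hBm : MeasurableSet B := measurableSet_le (measurable_linkEmbed L).norm measurable_const
  have hb0 : ∀ v, 0 ≤ B.indicator (fun _ => (1 : ℝ)) v := fun v => Set.indicator_nonneg (fun _ _ => zero_le_one) v
  have hb1 : ∀ v, B.indicator (fun _ => (1 : ℝ)) v ≤ 1 := fun v => Set.indicator_le_self' (fun _ _ => zero_le_one) v
  -- pointwise: integrand `≤ 𝟙_B·I·N̄(1+κ)`
  have hpt : ∀ x : Edge 3 L → Fin 3 → ℝ,
      ({x : LinkSpace L | linkCurry x ∈ capBalancedSet L}.indicator (fun _ => (1 : ℝ)) (linkEmbed L x) *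
            frozenProfile L (fun β' => stiffGaussExp L (β' / 2) β') (fun β' => min (1 / 40) (powScale (1 / 2) β' * btLog β')) β (linkEmbed L x)) ^ 2 *
          softWeight (recordChi L s K M β) (orthoTube L u x) ≤ (Nbar * (1 + κ)) * (B.indicator (fun _ => (1 : ℝ)) x * I x) := by
    intro x
    by_cases hx : x ∈ capBalancedSet L
    · rw [recordProfile_sq_mul_softWeight_eq s K M β u hx]
      have hN : F.indicator (gaugeAvg (recordChi L s K M β)) (orthoTube L u x) ≤ Nbar * (1 + κ) := by
        by_cases hU : orthoTube L u x ∈ F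
        · rw [Set.indicator_of_mem hU]; exact hP _ hU
        · rw [Set.indicator_of_notMem hU]; positivity
      have hN0 : 0 ≤ F.indicator (gaugeAvg (recordChi L s K M β)) (orthoTube L u x) := by
        by_cases hU : orthoTube L u x ∈ F
        · rw [Set.indicator_of_mem hU]
          obtain ⟨hm, h1, h0, -⟩ := recordChi_props (L := L) s K M β
          exact (gaugeAvg_mem_Icc hm (fun V => h0 V) (fun V => (abs_le.mp (h1 V)).2) _).1
        · rw [Set.indicator_of_notMem hU]
      calc B.indicator (fun _ => (1 : ℝ)) x * I x * F.indicator (gaugeAvg (recordChi L s K M β)) (orthoTube L u x)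
          ≤ B.indicator (fun _ => (1 : ℝ)) x * I x * (Nbar * (1 + κ)) := mul_le_mul_of_nonneg_left hN (mul_nonneg (hb0 x) (hI01 x).1)
        _ = (Nbar * (1 + κ)) * (B.indicator (fun _ => (1 : ℝ)) x * I x) := by ring
    · have h0 : {x : LinkSpace L | linkCurry x ∈ capBalancedSet L}.indicator (fun _ => (1 : ℝ)) (linkEmbed L x) = 0 :=
        Set.indicator_of_notMem (fun h => hx ((linkEmbed_mem_capLink_iff x).1 h)) _
      rw [h0, zero_mul, zero_pow two_ne_zero, zero_mul]
      exact mul_nonneg (by positivity) (mul_nonneg (hb0 x) (hI01 x).1)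
  have hw0 : ∀ U, 0 ≤ softWeight (recordChi L s K M β) U := (softWeight_recordChi_props (L := L) s K M β).2.2.1
  have hint : Integrable (fun x => B.indicator (fun _ => (1 : ℝ)) x * I x) (orthoTransverse L) :=
    integrable_of_measurable_abs_le _ ((measurable_const.indicator hBm).mul hIm) (C := 1) fun v => by
      rw [abs_mul, abs_of_nonneg (hb0 v), abs_of_nonneg (hI01 v).1]; exact mul_le_one₀ (hb1 v) (hI01 v).1 (hI01 v).2
  calc _ ≤ ∫ x, (Nbar * (1 + κ)) * (B.indicator (fun _ => (1 : ℝ)) x * I x) ∂orthoTransverse L :=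
        integral_mono_of_nonneg (ae_of_all _ fun x => mul_nonneg (sq_nonneg _) (hw0 _)) (hint.const_mul _) (ae_of_all _ hpt)
    _ = (1 + κ) * (Nbar * ∫ x, B.indicator (fun _ => (1 : ℝ)) x * I x ∂orthoTransverse L) := by rw [integral_const_mul]; ring
    _ = _ := by rw [recordGamma_eq]

set_option maxHeartbeats 800000 in
-- long record expressions.
/-- ★★ **THE ν-TAIL OF THE RECORD PROFILE OFF THE CORE OF RECORD, eventually in `β`** (`L ≥ 2` with a non-zero site, `0 < s ≤ 1/3`): there is `M₀ ≥ 2` such that for every `M ≥ M₀`,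
eventually in `β`, for EVERY slow `u`, with `S = {‖v̂‖ ≤ r_f/2} ∩ {‖P_Γv̂‖ ≤ β^{-1}ℓ}`, `Θ(v) = Ω_c(v̂)`, `w_u(v) = softWeight (recordChi L s K M β) (orthoTube u v)`:
`∫ (𝟙_{Sᶜ}Θ)²·w_u dπ ≤ N̄(β^{-1})·(2·(e^{−(gap/4)ℓ²} + e^{−ℓ²}))·π(univ)` ((P) `fpWeight_core_constant`: `N ≤ 2N̄` on the fat tube). [cite: Luscher1983, §3] -/
theorem eventually_fibre_tail_le_K {K : ℝ} (hK : 1 ≤ K) (hLz : Nonempty (NzSite L)) (hL : 2 ≤ L) {s : ℝ} (hs : 0 < s) (hs3 : s ≤ 1 / 3) :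
    ∃ M₀ : ℝ, 2 ≤ M₀ ∧ ∀ M : ℝ, M₀ ≤ M → ∀ᶠ β : ℝ in atTop, ∀ u : GaugeConfig 3 1 SU2,
      ∫ v, ({v : Edge 3 L → Fin 3 → ℝ | ‖linkEmbed L v‖ ≤ min (1 / 40) (powScale (1 / 2) β * btLog β) / 2 ∧
              ‖(gaugeModes L).starProjection (linkEmbed L v)‖ ≤ powScale 1 β * btLog β}ᶜ.indicator
            (fun v => {x : LinkSpace L | linkCurry x ∈ capBalancedSet L}.indicator (fun _ => (1 : ℝ)) (linkEmbed L v) *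
              frozenProfile L (fun β' => stiffGaussExp L (β' / 2) β') (fun β' => min (1 / 40) (powScale (1 / 2) β' * btLog β')) β (linkEmbed L v)) v) ^ 2 *
          softWeight (recordChi L s K M β) (orthoTube L u v) ∂orthoTransverse L ≤
        fpWeightBar L (powScale 1 β) * (2 * (Real.exp (-((2 - 2 * Real.cos (2 * Real.pi / L)) / 4 * btLog β ^ 2)) + Real.exp (-(btLog β ^ 2)))) *
          (orthoTransverse L).real Set.univ := by
  haveI := isFiniteMeasure_orthoTransverse L
  have hK0 : 0 < K := lt_of_lt_of_le one_pos hK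
  have hδ0 : ∀ β, 0 < K * powScale s β := fun β => mul_pos hK0 (powScale_pos s β)
  have hδ : Tendsto (fun β => K * powScale s β) atTop (𝓝 0) := by simpa using (tendsto_powScale hs).const_mul K
  have hsd1 : ∀ᶠ β in atTop, 0 < powScale 1 β ∧ powScale 1 β ≤ (K * powScale s β) ^ 3 := by
    filter_upwards [eventually_ge_atTop (1 : ℝ)] with β hβ
    have hp := powScale_pos 1 β
    have h1 : powScale 1 β ≤ powScale s β ^ 3 := powScale_one_le_cube hs3 hβ
    have hps0 : 0 ≤ powScale s β ^ 3 := pow_nonneg (powScale_pos s β).le 3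
    refine ⟨hp, h1.trans ?_⟩
    calc powScale s β ^ 3 = 1 * powScale s β ^ 3 := (one_mul _).symm
      _ ≤ K ^ 3 * powScale s β ^ 3 := mul_le_mul_of_nonneg_right (one_le_pow₀ hK) hps0
      _ = (K * powScale s β) ^ 3 := by ring
  obtain ⟨M₀, hM₀, H⟩ := fpWeight_core_constant L hLz hδ0 hδ hsd1
  refine ⟨M₀, hM₀, fun M hM => ?_⟩
  obtain ⟨C, β₀, hC, hP⟩ := H M hM
  have hδ2 : Tendsto (fun β => (K * powScale s β) ^ 2) atTop (𝓝 0) := by simpa using hδ.pow 2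
  filter_upwards [eventually_ge_atTop β₀, eventually_ge_atTop (1 : ℝ), eventually_ge_atTop (4 : ℝ), eventually_mul_le_of_tendsto hδ2 C one_pos,
    eventually_beta_mul_rf_sq] with β hβ0 hβ1 hβ4 hCδ hrf u
  set gap : ℝ := 2 - 2 * Real.cos (2 * Real.pi / L) with hgapdef
  have hβg : gap ≤ β := (gap_le_four L).trans hβ4
  set rf : ℝ := min (1 / 40) (powScale (1 / 2) β * btLog β) with hrfdef
  set τ : ℝ := powScale 1 β * btLog β with hτdef
  set Nbar := fpWeightBar L (powScale 1 β) with hNbar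
  have hNbar0 : 0 < Nbar := fpWeightBar_pos L (powScale_pos 1 β)
  have hrf0 : 0 ≤ rf / 2 := by
    have : 0 < rf := lt_min (by norm_num) (mul_pos (powScale_pos _ _) (lt_of_lt_of_le one_pos (one_le_btLog β)))
    linarith
  have hτ0 : 0 ≤ τ := mul_nonneg (powScale_pos 1 β).le (zero_le_one.trans (one_le_btLog β))
  -- the two exponents of record
  have hexp1 : Real.exp (-(β * gap * (rf / 2) ^ 2)) = Real.exp (-(gap / 4 * btLog β ^ 2)) := by
    congr 1; rw [div_pow, show β * gap * (rf ^ 2 / 2 ^ 2) = gap / 4 * (β * rf ^ 2) by ring, hrf]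
  have hexp2 : Real.exp (-(τ ^ 2 / powScale 1 β ^ 2)) = Real.exp (-(btLog β ^ 2)) := by
    congr 1; rw [hτdef, mul_pow]; field_simp [(powScale_pos 1 β).ne']
  set ε : ℝ := Real.exp (-(gap / 4 * btLog β ^ 2)) + Real.exp (-(btLog β ^ 2)) with hεdef
  have hε0 : 0 ≤ ε := add_nonneg (Real.exp_pos _).le (Real.exp_pos _).le
  -- pointwise bound of the integrand by the constant `N̄·2ε`
  set S : Set (Edge 3 L → Fin 3 → ℝ) := {v | ‖linkEmbed L v‖ ≤ rf / 2 ∧ ‖(gaugeModes L).starProjection (linkEmbed L v)‖ ≤ τ} with hSdef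
  set F := fatTubeRho L (fun β => K * powScale s β) (fun b => M * (K * powScale s b)) β with hFdef
  have hw0 : ∀ U, 0 ≤ softWeight (recordChi L s K M β) U := (softWeight_recordChi_props (L := L) s K M β).2.2.1
  have hpt : ∀ v : Edge 3 L → Fin 3 → ℝ,
      (Sᶜ.indicator (fun v => {x : LinkSpace L | linkCurry x ∈ capBalancedSet L}.indicator (fun _ => (1 : ℝ)) (linkEmbed L v) *
            frozenProfile L (fun β' => stiffGaussExp L (β' / 2) β') (fun β' => min (1 / 40) (powScale (1 / 2) β' * btLog β')) β (linkEmbed L v)) v) ^ 2 *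
          softWeight (recordChi L s K M β) (orthoTube L u v) ≤ Nbar * (2 * ε) := by
    intro v
    have hK0 : 0 ≤ Nbar * (2 * ε) := by positivity
    by_cases hvS : v ∈ Sᶜ
    swap
    · rw [Set.indicator_of_notMem hvS]; simpa using hK0
    rw [Set.indicator_of_mem hvS]
    by_cases hv : v ∈ capBalancedSet L
    swap
    · have h0 : {x : LinkSpace L | linkCurry x ∈ capBalancedSet L}.indicator (fun _ => (1 : ℝ)) (linkEmbed L v) = 0 :=
        Set.indicator_of_notMem (fun h => hv ((linkEmbed_mem_capLink_iff v).1 h)) _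
      rw [h0, zero_mul]; simpa using hK0
    rw [recordProfile_sq_mul_softWeight_eq s K M β u hv]
    -- the `F`-indicator of `N` is `≤ N̄(1 + Cδ²) ≤ 2N̄`
    have hN : F.indicator (gaugeAvg (recordChi L s K M β)) (orthoTube L u v) ≤ Nbar * 2 := by
      by_cases hU : orthoTube L u v ∈ F
      · rw [Set.indicator_of_mem hU]
        have h := (hP β hβ0 _ hU).2
        have : Nbar * (1 + C * (K * powScale s β) ^ 2) ≤ Nbar * 2 := mul_le_mul_of_nonneg_left (by linarith) hNbar0.le
        exact h.trans this
      · rw [Set.indicator_of_notMem hU]; positivity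
    have hN0 : 0 ≤ F.indicator (gaugeAvg (recordChi L s K M β)) (orthoTube L u v) := by
      by_cases hU : orthoTube L u v ∈ F
      · rw [Set.indicator_of_mem hU]
        obtain ⟨hm, h1, h0, -⟩ := recordChi_props (L := L) s K M β
        exact (gaugeAvg_mem_Icc hm (fun V => h0 V) (fun V => (abs_le.mp (h1 V)).2) _).1
      · rw [Set.indicator_of_notMem hU]
    -- the ball indicator is `≤ 1`, the Gaussian-stiff integrand off `S` is `≤ ε`
    have hball1 : {v : Edge 3 L → Fin 3 → ℝ | ‖linkEmbed L v‖ ≤ min (1 / 40) (powScale (1 / 2) β * btLog β)}.indicator (fun _ => (1 : ℝ)) v ≤ 1 :=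
      Set.indicator_le_self' (fun _ _ => zero_le_one) v
    have hball0 : 0 ≤ {v : Edge 3 L → Fin 3 → ℝ | ‖linkEmbed L v‖ ≤ min (1 / 40) (powScale (1 / 2) β * btLog β)}.indicator (fun _ => (1 : ℝ)) v :=
      Set.indicator_nonneg (fun _ _ => zero_le_one) v
    have hint := core_compl_integrand_le (L := L) hL hβ1 hβg hv.1 hrf0 hτ0
    rw [Set.indicator_of_mem hvS, one_mul, hexp1, hexp2] at hint
    have hI0 : 0 ≤ Real.exp (-(stiffGaussExp L (β / 2) β (linkEmbed L v))) ^ 2 * Real.exp (-(‖(gaugeModes L).starProjection (linkEmbed L v)‖ ^ 2 / powScale 1 β ^ 2)) := by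
      positivity
    calc _ ≤ 1 * ε * (Nbar * 2) := mul_le_mul (mul_le_mul hball1 hint hI0 zero_le_one) hN hN0 (by positivity)
      _ = Nbar * (2 * ε) := by ring
  calc _ ≤ ∫ _v, Nbar * (2 * ε) ∂orthoTransverse L :=
        integral_mono_of_nonneg (ae_of_all _ fun v => mul_nonneg (sq_nonneg _) (hw0 _)) (integrable_const _) (ae_of_all _ hpt)
    _ = fpWeightBar L (powScale 1 β) * (2 * ε) * (orthoTransverse L).real Set.univ := by
        rw [integral_const, smul_eq_mul, hNbar]; ring

set_option maxHeartbeats 800000 in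
-- long record expressions.
/-- ★★★ **THE ν-TAIL IS AN ARBITRARILY SMALL MULTIPLE OF THE FIBRE-MASS CONSTANT**: with `M₀` as above, for every `M ≥ M₀` and EVERY `a > 0`, eventually in `β`, for every slow `u`,
`∫ (𝟙_{Sᶜ}Θ)²·w_u dπ ≤ a·γ(β)`, `γ = recordGamma L Ω_c β = N̄·M₂` (`…BORecordGamma.recordGamma_eq`, `M₂ ≥ M₂^{in} ≥ e^{−99}c_b(β^{-1})^{6|E|}` by
`…BODefectShellRate.inner_mass_poly_floor`).  With `Z_u ∈ (1±κ)γ` (`…FibreMassBrick.fibreMass_brick_record`) and §1 this is the `C ≤ o(1)·N` input of `form_le_of_product_near`. [cite: Luscher1983, §3] -/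
theorem eventually_fibre_tail_le_mul_recordGamma_K {K : ℝ} (hK : 1 ≤ K) (hLz : Nonempty (NzSite L)) (hL : 2 ≤ L) {s : ℝ} (hs : 0 < s) (hs3 : s ≤ 1 / 3) :
    ∃ M₀ : ℝ, 2 ≤ M₀ ∧ ∀ M : ℝ, M₀ ≤ M → ∀ a : ℝ, 0 < a → ∀ᶠ β : ℝ in atTop, ∀ u : GaugeConfig 3 1 SU2,
      ∫ v, ({v : Edge 3 L → Fin 3 → ℝ | ‖linkEmbed L v‖ ≤ min (1 / 40) (powScale (1 / 2) β * btLog β) / 2 ∧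
              ‖(gaugeModes L).starProjection (linkEmbed L v)‖ ≤ powScale 1 β * btLog β}ᶜ.indicator
            (fun v => {x : LinkSpace L | linkCurry x ∈ capBalancedSet L}.indicator (fun _ => (1 : ℝ)) (linkEmbed L v) *
              frozenProfile L (fun β' => stiffGaussExp L (β' / 2) β') (fun β' => min (1 / 40) (powScale (1 / 2) β' * btLog β')) β (linkEmbed L v)) v) ^ 2 *
          softWeight (recordChi L s K M β) (orthoTube L u v) ∂orthoTransverse L ≤
        a * recordGamma L (fun β' => fun x : LinkSpace L => {x : LinkSpace L | linkCurry x ∈ capBalancedSet L}.indicator (fun _ => (1 : ℝ)) x *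
          frozenProfile L (fun β'' => stiffGaussExp L (β'' / 2) β'') (fun β'' => min (1 / 40) (powScale (1 / 2) β'' * btLog β'')) β' x) β := by
  haveI := isFiniteMeasure_orthoTransverse L
  obtain ⟨M₀, hM₀, H⟩ := eventually_fibre_tail_le_K (L := L) hK hLz hL hs hs3
  refine ⟨M₀, hM₀, fun M hM a ha => ?_⟩
  have hgap : 0 < 2 - 2 * Real.cos (2 * Real.pi / L) := gap_pos L hL
  set cb : ℝ := Real.exp (-99) * ((1 / (20 * Fintype.card (Edge 3 L))) ^ 3 / 10) ^ Fintype.card (Edge 3 L) with hcbdef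
  have hE : (0 : ℝ) < Fintype.card (Edge 3 L) := by exact_mod_cast Fintype.card_pos
  have hcb : 0 < cb := by rw [hcbdef]; positivity
  -- budget: `4·e^{−(gap/4)ℓ²}·π(univ) ≤ a·c_b·(β^{-1})^{6|E|}` eventually
  have hbud := eventually_exp_neg_btLog_sq_le (q := (2 - 2 * Real.cos (2 * Real.pi / L)) / 4) (P := 4 * (orthoTransverse L).real Set.univ) (by positivity)
    (by positivity) (mul_pos ha hcb) (6 * Fintype.card (Edge 3 L))
  filter_upwards [H M hM, hbud, inner_mass_poly_floor (L := L)] with β htail hb hfloor u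
  refine (htail u).trans ?_
  set Nbar := fpWeightBar L (powScale 1 β) with hNbar
  have hNbar0 : 0 < Nbar := fpWeightBar_pos L (powScale_pos 1 β)
  set ℓ2 := btLog β ^ 2
  -- `e^{−ℓ²} ≤ e^{−(gap/4)ℓ²}` since `gap ≤ 4`
  have hcmp : Real.exp (-(btLog β ^ 2)) ≤ Real.exp (-((2 - 2 * Real.cos (2 * Real.pi / L)) / 4 * btLog β ^ 2)) := by
    rw [Real.exp_le_exp, neg_le_neg_iff]
    have h4 := gap_le_four L
    have hl : 0 ≤ btLog β ^ 2 := sq_nonneg _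
    nlinarith
  -- the reference mass from below: `γ = N̄·M₂ ≥ N̄·M₂^{in} ≥ N̄·floor`
  set I : (Edge 3 L → Fin 3 → ℝ) → ℝ := fun v =>
    Real.exp (-(stiffGaussExp L (β / 2) β (linkEmbed L v))) ^ 2 * Real.exp (-(‖(gaugeModes L).starProjection (linkEmbed L v)‖ ^ 2 / powScale 1 β ^ 2)) with hIdef
  have hIm : Measurable I := measurable_record_integrand (L := L) β
  have hI01 : ∀ v, 0 ≤ I v ∧ I v ≤ 1 := fun v => by
    refine ⟨by rw [hIdef]; positivity, ?_⟩
    have h1 : Real.exp (-(stiffGaussExp L (β / 2) β (linkEmbed L v))) ^ 2 ≤ 1 :=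
      pow_le_one₀ (Real.exp_pos _).le (Real.exp_le_one_iff.mpr (neg_nonpos.mpr (stiffGaussExp_nonneg _ _ _)))
    have h2 : Real.exp (-(‖(gaugeModes L).starProjection (linkEmbed L v)‖ ^ 2 / powScale 1 β ^ 2)) ≤ 1 :=
      Real.exp_le_one_iff.mpr (neg_nonpos.mpr (by positivity))
    calc I v ≤ 1 * 1 := mul_le_mul h1 h2 (Real.exp_pos _).le zero_le_one
      _ = 1 := one_mul _
  have hl : Continuous fun v : Edge 3 L → Fin 3 → ℝ => linkEmbed L v := (linkEmbed L).continuous_of_finiteDimensional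
  have hmeasBall : ∀ c : ℝ, MeasurableSet {v : Edge 3 L → Fin 3 → ℝ | ‖linkEmbed L v‖ ≤ c} := fun c =>
    measurableSet_le hl.norm.measurable measurable_const
  have hmono : ∫ v, {v : Edge 3 L → Fin 3 → ℝ | ‖linkEmbed L v‖ ≤ min (1 / 40) (powScale (1 / 2) β * btLog β) / 12}.indicator (fun _ => (1 : ℝ)) v * I v ∂orthoTransverse L ≤
      ∫ v, {v : Edge 3 L → Fin 3 → ℝ | ‖linkEmbed L v‖ ≤ min (1 / 40) (powScale (1 / 2) β * btLog β)}.indicator (fun _ => (1 : ℝ)) v * I v ∂orthoTransverse L := by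
    refine integral_mono_of_nonneg (ae_of_all _ fun v => mul_nonneg (Set.indicator_nonneg (fun _ _ => zero_le_one) v) (hI01 v).1) ?_ (ae_of_all _ fun v => ?_)
    · exact integrable_of_measurable_abs_le _ ((measurable_const.indicator (hmeasBall _)).mul hIm) (C := 1) fun v => by
        rw [abs_mul, abs_of_nonneg (Set.indicator_nonneg (fun _ _ => zero_le_one) v), abs_of_nonneg (hI01 v).1]
        exact mul_le_one₀ (Set.indicator_le_self' (fun _ _ => zero_le_one) v) (hI01 v).1 (hI01 v).2
    · refine mul_le_mul_of_nonneg_right ?_ (hI01 v).1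
      by_cases h : v ∈ {v : Edge 3 L → Fin 3 → ℝ | ‖linkEmbed L v‖ ≤ min (1 / 40) (powScale (1 / 2) β * btLog β) / 12}
      · have h' : v ∈ {v : Edge 3 L → Fin 3 → ℝ | ‖linkEmbed L v‖ ≤ min (1 / 40) (powScale (1 / 2) β * btLog β)} := by
          simp only [Set.mem_setOf_eq] at h ⊢
          have : 0 ≤ min (1 / 40) (powScale (1 / 2) β * btLog β) :=
            le_min (by norm_num) (mul_nonneg (powScale_pos _ _).le (zero_le_one.trans (one_le_btLog β)))
          linarith
        rw [Set.indicator_of_mem h, Set.indicator_of_mem h']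
      · rw [Set.indicator_of_notMem h]; exact Set.indicator_nonneg (fun _ _ => zero_le_one) v
  have hγ : Nbar * (cb * powScale 1 β ^ (6 * Fintype.card (Edge 3 L))) ≤
      recordGamma L (fun β' => fun x : LinkSpace L => {x : LinkSpace L | linkCurry x ∈ capBalancedSet L}.indicator (fun _ => (1 : ℝ)) x *
        frozenProfile L (fun β'' => stiffGaussExp L (β'' / 2) β'') (fun β'' => min (1 / 40) (powScale (1 / 2) β'' * btLog β'')) β' x) β := by
    rw [recordGamma_eq, ← hNbar]
    exact mul_le_mul_of_nonneg_left (hfloor.trans hmono) hNbar0.le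
  -- assemble
  have hsum : 2 * (Real.exp (-((2 - 2 * Real.cos (2 * Real.pi / L)) / 4 * btLog β ^ 2)) + Real.exp (-(btLog β ^ 2))) * (orthoTransverse L).real Set.univ ≤
      a * (cb * powScale 1 β ^ (6 * Fintype.card (Edge 3 L))) := by
    have hπ0 : 0 ≤ (orthoTransverse L).real Set.univ := measureReal_nonneg
    calc 2 * (Real.exp (-((2 - 2 * Real.cos (2 * Real.pi / L)) / 4 * btLog β ^ 2)) + Real.exp (-(btLog β ^ 2))) * (orthoTransverse L).real Set.univ
        ≤ 2 * (2 * Real.exp (-((2 - 2 * Real.cos (2 * Real.pi / L)) / 4 * btLog β ^ 2))) * (orthoTransverse L).real Set.univ := by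
          refine mul_le_mul_of_nonneg_right (mul_le_mul_of_nonneg_left (by linarith) (by norm_num)) hπ0
      _ = 4 * (orthoTransverse L).real Set.univ * Real.exp (-((2 - 2 * Real.cos (2 * Real.pi / L)) / 4 * btLog β ^ 2)) := by ring
      _ ≤ a * cb * powScale 1 β ^ (6 * Fintype.card (Edge 3 L)) := hb
      _ = a * (cb * powScale 1 β ^ (6 * Fintype.card (Edge 3 L))) := by ring
  calc fpWeightBar L (powScale 1 β) * (2 * (Real.exp (-((2 - 2 * Real.cos (2 * Real.pi / L)) / 4 * btLog β ^ 2)) + Real.exp (-(btLog β ^ 2)))) *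
        (orthoTransverse L).real Set.univ
      = Nbar * (2 * (Real.exp (-((2 - 2 * Real.cos (2 * Real.pi / L)) / 4 * btLog β ^ 2)) + Real.exp (-(btLog β ^ 2))) * (orthoTransverse L).real Set.univ) := by
        rw [hNbar]; ring
    _ ≤ Nbar * (a * (cb * powScale 1 β ^ (6 * Fintype.card (Edge 3 L)))) := mul_le_mul_of_nonneg_left hsum hNbar0.le
    _ = a * (Nbar * (cb * powScale 1 β ^ (6 * Fintype.card (Edge 3 L)))) := by ring
    _ ≤ _ := mul_le_mul_of_nonneg_left hγ ha.le

end Summit.QuantumFields.YangMills.Theorems.FemtoTransferGap.TwoLattice.ConstTube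

end
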